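import Mathlib.Topology.Algebra.Group.Quotient
import Literature.AnabelianGeometry.SemiGraphs.PSCProofs
import Literature.AnabelianGeometry.SemiGraphs.PSCGraphicProofs
import HarnessLib

/-!
# The compactification `G'` of a PSC datum: `Π_G ↠ Π^cpt_G`, cusps omitted ([CombGC] Rmk. 1.1.6)

Mochizuki, *A combinatorial version of the Grothendieck conjecture*, Tohoku Math. J. **59** (2007),
Remark 1.1.6, author's ms p. 8: "Suppose that `G` is sturdy. Then observe that the quotient
`Π_G ↠ Π^cpt_G` determines a new semi-graph of anabelioids `G'` of PSC-type, which we shall refer to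
as the *compactification* of `G`. That is to say, the underlying semi-graph `𝔾'` of `G'` is obtained
from the underlying semi-graph `𝔾` of `G` by omitting the cusps. The anabelioids at the vertices
and edges of `G'` are then obtained from `G` as the subcategories of the corresponding anabelioids
of `G` determined by the quotients of the corresponding verticial and edge-like subgroups of `Π_G`
induced by the quotient `Π_G ↠ Π^cpt_G`. Thus, it follows immediately that we obtain a natural
isomorphism `Π^cpt_G ⥲ Π_{G'}`." [cite: MochizukiCombGC2007, Rmk 1.1.6 p.8]  Used in the proof of
Thm. 1.6 (ii) p. 14 ("by replacing `G`, `H` by their respective compactifications … we may assume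
that `G`, `H` are noncuspidal") — row T16-L09 of the abc-iut [CombGC] Thm 1.6 sub-DAG (ruling
α11-3: def = seat abc-iut-L3-t4; transfer lemmas = abc-iut-w5-d188).

Over the interface `PSCDatum Π` (`PSCFundamentalGroup.lean`) this file DEFINES, for a continuous
surjection `f : Π_G ↠ Q` presenting the compactified quotient (`compactifyAlong`; the canonical
choice `f = (Π_G ↠ Π_G / cptKer)` is `compactify`), the datum `G'` over `Q`: underlying semi-graph
`PSCSemiGraph.compactify` (same vertices and nodes, NO cusps), verticial / nodal subgroups the
IMAGES `f(Π_v)`, `f(Π_e)`, `Σ` and the genera unchanged.  The images are closed because `Π_G` is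
compact and `Q` Hausdorff (hypotheses of the construction; every PSC-fundamental group is
profinite); `Q` is pro-`Σ` as a continuous image.  Print defines the compactification only for
STURDY `G` (so that the cusp-less pointed curve is still stable); the datum below is defined for
every `G`, and sturdiness enters exactly where print uses it: in the origin-level statement
`CompactifyOfPSCTypeHolds` ("`G'` is of PSC-type").  Also proved here (defining equations and the
Def. 1.1 (ii) vocabulary of `G'`): `isVerticial_compactifyAlong_iff` / `isNodal_…` (verticial and
nodal subgroups of `Π_{G'}` are the images of those of `Π_G`), no cuspidal subgroups,
`compactifyAlong_cptKer` (`Π_{G'} = Π^cpt_{G'}`), noncuspidal, `IsSturdy` unchanged.  Nothing here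
asserts anything about pointed stable curves; no statement takes a side on [IUTchIII] Cor. 3.12.
-/

namespace Literature.AnabelianGeometry.SemiGraphs

open scoped Pointwise

universe u

/-! ### The cusp-less semi-graph -/

namespace PSCSemiGraph

/-- The underlying semi-graph of the compactification: "obtained from the underlying semi-graph
`𝔾` of `G` by omitting the cusps" (same vertices, same nodes, no cusps).
[cite: MochizukiCombGC2007, Rmk 1.1.6 p.8] -/
def compactify (𝔾 : PSCSemiGraph) : PSCSemiGraph where
  V := 𝔾.V
  N := 𝔾.N
  C := Fin 0
  nodeEnds := 𝔾.nodeEnds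
  cuspEnd := fun c => c.elim0

/-- The compactified semi-graph has no cusps: `r(G') = 0`. [cite: MochizukiCombGC2007, Rmk 1.1.6 p.8] -/
@[simp] theorem compactify_r (𝔾 : PSCSemiGraph) : 𝔾.compactify.r = 0 := rfl

/-- `n(G') = n(G)`. [cite: MochizukiCombGC2007, Rmk 1.1.6 p.8] -/
@[simp] theorem compactify_n (𝔾 : PSCSemiGraph) : 𝔾.compactify.n = 𝔾.n := rfl

/-- `i(G') = i(G)`. [cite: MochizukiCombGC2007, Rmk 1.1.6 p.8] -/
@[simp] theorem compactify_i (𝔾 : PSCSemiGraph) : 𝔾.compactify.i = 𝔾.i := rfl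

/-- `G'` is noncuspidal. [cite: MochizukiCombGC2007, Rmk 1.1.6 p.8] -/
theorem compactify_isNoncuspidal (𝔾 : PSCSemiGraph) : 𝔾.compactify.IsNoncuspidal := rfl

end PSCSemiGraph

namespace PSCDatum

variable {P : Type u} [Group P] [TopologicalSpace P] (G : PSCDatum P)
variable {Q : Type u} [Group Q] [TopologicalSpace Q]

/-! ### Plumbing: conjugates of images (`map_conj_smul` is `PSCGraphicProofs`'), pro-`Σ` images -/

omit [TopologicalSpace P] [TopologicalSpace Q] in
/-- Every conjugate in `Q` of an image is the image of a conjugate, `f` surjective.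
[cite: MochizukiCombGC2007, Rmk 1.1.6 p.8] -/
theorem exists_smul_map_eq {f : P →* Q} (hs : Function.Surjective f) (δ : ConjAct Q)
    (H : Subgroup P) : ∃ γ : ConjAct P, δ • H.map f = (γ • H).map f := by
  obtain ⟨p, hp⟩ := hs (ConjAct.ofConjAct δ)
  refine ⟨ConjAct.toConjAct p, ?_⟩
  rw [map_conj_smul, ConjAct.ofConjAct_toConjAct, hp, ConjAct.toConjAct_ofConjAct]

/-- Pro-`Σ` passes to continuous homomorphic images (cf. the L5 copy
`Literature.IUT.HodgeTheaters.isProSigma_of_surjective`, not importable here for layering).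
[cite: MochizukiCombGC2007, Def 1.1(ii) p.6] -/
private theorem isProSigma_map {S : Set ℕ} (hP : IsProSigma S P) (f : P →* Q) (hf : Continuous f)
    (hs : Function.Surjective f) : IsProSigma S Q := by
  refine ⟨fun N' hfin p hp hdvd => ?_⟩
  let N : OpenNormalSubgroup P :=
    { toSubgroup := N'.toSubgroup.comap f
      isOpen' := N'.isOpen'.preimage hf
      isNormal' := inferInstance }
  have hker : ((QuotientGroup.mk' N'.toSubgroup).comp f).ker = N.toSubgroup := by
    rw [← MonoidHom.comap_ker, QuotientGroup.ker_mk']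
  have hsurj : Function.Surjective ((QuotientGroup.mk' N'.toSubgroup).comp f) :=
    (QuotientGroup.mk'_surjective _).comp hs
  have hequiv : P ⧸ N.toSubgroup ≃ Q ⧸ N'.toSubgroup := by
    rw [← hker]
    exact (QuotientGroup.quotientKerEquivOfSurjective _ hsurj).toEquiv
  haveI : Finite (P ⧸ N.toSubgroup) := Finite.of_equiv _ hequiv.symm
  refine hP.prime_mem N inferInstance p hp ?_
  rwa [Nat.card_congr hequiv]

omit [TopologicalSpace P] [TopologicalSpace Q] in
/-- Along a surjection `f : Π ↠ Q` whose kernel lies in `H`, the double cosets `H \ Π / K` and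
`f(H) \ Q / f(K)` correspond (the vertices / nodes of the covering `G_H` of `G` and of the covering
of `G'` attached to `f(H)`). [cite: MochizukiCombGC2007, Rmk 1.1.6 p.8] -/
theorem card_doubleCosetQuotient_map {f : P →* Q} (hs : Function.Surjective f) {H : Subgroup P}
    (hH : f.ker ≤ H) (K : Subgroup P) :
    Nat.card (DoubleCoset.Quotient ((H.map f : Subgroup Q) : Set Q) ((K.map f : Subgroup Q) : Set Q)) =
      Nat.card (DoubleCoset.Quotient (H : Set P) (K : Set P)) := by
  let φ : DoubleCoset.Quotient (H : Set P) (K : Set P) →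
      DoubleCoset.Quotient ((H.map f : Subgroup Q) : Set Q) ((K.map f : Subgroup Q) : Set Q) :=
    Quotient.map' f fun a b hab => by
      obtain ⟨h, hh, k, hk, rfl⟩ := DoubleCoset.rel_iff.mp hab
      exact DoubleCoset.rel_iff.mpr ⟨f h, ⟨h, hh, rfl⟩, f k, ⟨k, hk, rfl⟩, by rw [map_mul, map_mul]⟩
  refine (Nat.card_congr (Equiv.ofBijective φ ⟨?_, ?_⟩)).symm
  · intro a b hab
    induction a using Quotient.inductionOn' with | h a => ?_
    induction b using Quotient.inductionOn' with | h b => ?_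
    obtain ⟨h', ⟨h, hh, rfl⟩, k', ⟨k, hk, rfl⟩, e⟩ :=
      (DoubleCoset.eq _ _ _ _).mp (show DoubleCoset.mk _ _ (f a) = DoubleCoset.mk _ _ (f b) from hab)
    refine Quotient.sound' (DoubleCoset.rel_iff.mpr ⟨b * (h * a * k)⁻¹ * h, H.mul_mem (hH ?_) hh, k, hk,
      by simp only [mul_assoc, mul_inv_rev, inv_mul_cancel, mul_one]⟩)
    rw [MonoidHom.mem_ker, map_mul, map_inv, e, map_mul, map_mul, mul_inv_cancel]
  · intro q
    induction q using Quotient.inductionOn' with | h x => ?_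
    obtain ⟨a, rfl⟩ := hs x
    exact ⟨Quotient.mk'' a, rfl⟩

/-! ### The compactification datum along a presentation `f : Π_G ↠ Q` of `Π^cpt_G` -/

section Along

variable [CompactSpace P] [T2Space Q] (f : P →* Q) (hf : Continuous f) (hs : Function.Surjective f)

/-- **[CombGC] Rmk. 1.1.6: the compactification of `G`, presented along `f`.**  For a continuous
surjection `f : Π_G ↠ Q` (intended: a presentation of `Π_G ↠ Π^cpt_G`, i.e. `ker f = cptKer`;
cf. `compactify`), the PSC datum over `Q` with the cusps omitted, verticial / nodal subgroups the
images `f(Π_v)`, `f(Π_e)` ("the quotients of the corresponding verticial and edge-like subgroups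
induced by `Π_G ↠ Π^cpt_G`"), same `Σ` and genera.  `Π_G` compact and `Q` Hausdorff make the images
closed. [cite: MochizukiCombGC2007, Rmk 1.1.6 p.8] -/
noncomputable def compactifyAlong : PSCDatum Q where
  Sigma := G.Sigma
  sigma_prime := G.sigma_prime
  sigma_nonempty := G.sigma_nonempty
  graph := G.graph.compactify
  vertGp v := (G.vertGp v).map f
  nodeGp e := (G.nodeGp e).map f
  cuspGp c := c.elim0
  genus := G.genus
  isClosed_vertGp v := ((G.isClosed_vertGp v).isCompact.image hf).isClosed
  isClosed_nodeGp e := ((G.isClosed_nodeGp e).isCompact.image hf).isClosed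
  isClosed_cuspGp c := c.elim0
  nodeGp_le e := by
    obtain ⟨v₁, v₂, he, ⟨γ₁, h₁⟩, ⟨γ₂, h₂⟩⟩ := G.nodeGp_le e
    exact ⟨v₁, v₂, he, ⟨_, (map_conj_smul f γ₁ _).symm.trans_le (Subgroup.map_mono h₁)⟩,
      ⟨_, (map_conj_smul f γ₂ _).symm.trans_le (Subgroup.map_mono h₂)⟩⟩
  cuspGp_le c := c.elim0
  proSigma := isProSigma_map G.proSigma f hf hs

/-- Same `Σ`. [cite: MochizukiCombGC2007, Rmk 1.1.6 p.8] -/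
@[simp] theorem compactifyAlong_Sigma : (G.compactifyAlong f hf hs).Sigma = G.Sigma := rfl

/-- The underlying semi-graph is `𝔾` with the cusps omitted. [cite: MochizukiCombGC2007, Rmk 1.1.6 p.8] -/
@[simp] theorem compactifyAlong_graph : (G.compactifyAlong f hf hs).graph = G.graph.compactify := rfl

/-- `Π_{v}' = f(Π_v)`. [cite: MochizukiCombGC2007, Rmk 1.1.6 p.8] -/
@[simp] theorem compactifyAlong_vertGp (v : G.graph.V) :
    (G.compactifyAlong f hf hs).vertGp v = (G.vertGp v).map f := rfl

/-- `Π_{e}' = f(Π_e)`. [cite: MochizukiCombGC2007, Rmk 1.1.6 p.8] -/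
@[simp] theorem compactifyAlong_nodeGp (e : G.graph.N) :
    (G.compactifyAlong f hf hs).nodeGp e = (G.nodeGp e).map f := rfl

/-- The genera are unchanged. [cite: MochizukiCombGC2007, Rmk 1.1.6 p.8] -/
@[simp] theorem compactifyAlong_genus (v : G.graph.V) :
    (G.compactifyAlong f hf hs).genus v = G.genus v := rfl

/-- `G'` is sturdy iff `G` is. [cite: MochizukiCombGC2007, Rmk 1.1.6 p.8] -/
theorem isSturdy_compactifyAlong_iff : (G.compactifyAlong f hf hs).IsSturdy ↔ G.IsSturdy := Iff.rfl

/-- **Verticial subgroups of `Π_{G'}`** are exactly the images `f(B)` of the verticial subgroups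
`B` of `Π_G`. [cite: MochizukiCombGC2007, Rmk 1.1.6 p.8] -/
theorem isVerticial_compactifyAlong_iff (A : Subgroup Q) :
    (G.compactifyAlong f hf hs).IsVerticial A ↔ ∃ B, G.IsVerticial B ∧ A = B.map f := by
  constructor
  · rintro ⟨v, δ, rfl⟩
    obtain ⟨γ, hγ⟩ := exists_smul_map_eq hs δ (G.vertGp v)
    exact ⟨γ • G.vertGp v, ⟨v, γ, rfl⟩, hγ⟩
  · rintro ⟨B, ⟨v, γ, rfl⟩, rfl⟩
    exact ⟨v, _, map_conj_smul f γ _⟩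

/-- **Nodal subgroups of `Π_{G'}`** are exactly the images of the nodal subgroups of `Π_G`.
[cite: MochizukiCombGC2007, Rmk 1.1.6 p.8] -/
theorem isNodal_compactifyAlong_iff (A : Subgroup Q) :
    (G.compactifyAlong f hf hs).IsNodal A ↔ ∃ B, G.IsNodal B ∧ A = B.map f := by
  constructor
  · rintro ⟨e, δ, rfl⟩
    obtain ⟨γ, hγ⟩ := exists_smul_map_eq hs δ (G.nodeGp e)
    exact ⟨γ • G.nodeGp e, ⟨e, γ, rfl⟩, hγ⟩
  · rintro ⟨B, ⟨e, γ, rfl⟩, rfl⟩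
    exact ⟨e, _, map_conj_smul f γ _⟩

/-- `G'` has no cuspidal subgroups. [cite: MochizukiCombGC2007, Rmk 1.1.6 p.8] -/
theorem not_isCuspidal_compactifyAlong (A : Subgroup Q) : ¬ (G.compactifyAlong f hf hs).IsCuspidal A :=
  fun ⟨c, _⟩ => c.elim0

/-- The edge-like subgroups of `Π_{G'}` are its nodal subgroups, the images of the nodal subgroups
of `Π_G`. [cite: MochizukiCombGC2007, Rmk 1.1.6 p.8] -/
theorem isEdgeLike_compactifyAlong_iff (A : Subgroup Q) :
    (G.compactifyAlong f hf hs).IsEdgeLike A ↔ ∃ B, G.IsNodal B ∧ A = B.map f := by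
  rw [IsEdgeLike, isNodal_compactifyAlong_iff, or_iff_left (G.not_isCuspidal_compactifyAlong f hf hs A)]

/-- `Π_{G'} ↠ Π^cpt_{G'}` is an isomorphism: the compactification has trivial `cptKer`
(no cusps; `Q` is `T₁`). [cite: MochizukiCombGC2007, Rmk 1.1.6 p.8] -/
theorem compactifyAlong_cptKer [IsTopologicalGroup Q] : (G.compactifyAlong f hf hs).cptKer = ⊥ := by
  have h0 : (⋃ c : (G.compactifyAlong f hf hs).graph.C,
      ((G.compactifyAlong f hf hs).cuspGp c : Set Q)) = ∅ :=
    Set.iUnion_eq_empty.mpr fun c => c.elim0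
  have h1 : Subgroup.normalClosure (⋃ c : (G.compactifyAlong f hf hs).graph.C,
      ((G.compactifyAlong f hf hs).cuspGp c : Set Q)) = ⊥ := by
    rw [h0]
    exact le_bot_iff.mp (Subgroup.normalClosure_le_normal (Set.empty_subset _))
  rw [cptKer, h1]
  exact le_bot_iff.mp (Subgroup.topologicalClosure_minimal _ le_rfl
    (by rw [Subgroup.coe_bot]; exact isClosed_singleton))

/-- Every covering of `G'` is noncuspidal: `r = 0`. [cite: MochizukiCombGC2007, Rmk 1.1.6 p.8] -/
@[simp] theorem compactifyAlong_cuspCount (H : Subgroup Q) : (G.compactifyAlong f hf hs).cuspCount H = 0 := by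
  simp [cuspCount, compactifyAlong, PSCSemiGraph.compactify]

/-- `i` of the covering of `G'` attached to `f(H)` is `i(G_H)` when `ker f ⊆ H` (the `Π^cpt`-coverings
of `G` and the coverings of `G'` correspond). [cite: MochizukiCombGC2007, Rmk 1.1.6 p.8] -/
theorem compactifyAlong_vertCount {H : Subgroup P} (hH : f.ker ≤ H) :
    (G.compactifyAlong f hf hs).vertCount (H.map f) = G.vertCount H :=
  Finset.sum_congr rfl fun v _ => card_doubleCosetQuotient_map hs hH (G.vertGp v)

/-- `n` of the covering of `G'` attached to `f(H)` is `n(G_H)` when `ker f ⊆ H`.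
[cite: MochizukiCombGC2007, Rmk 1.1.6 p.8] -/
theorem compactifyAlong_nodeCount {H : Subgroup P} (hH : f.ker ≤ H) :
    (G.compactifyAlong f hf hs).nodeCount (H.map f) = G.nodeCount H :=
  Finset.sum_congr rfl fun e _ => card_doubleCosetQuotient_map hs hH (G.nodeGp e)

end Along

/-! ### The canonical presentation `Π_G ↠ Π_G / cptKer` -/

section Canonical

variable [IsTopologicalGroup P] [CompactSpace P]

omit [CompactSpace P] in
/-- `Π^cpt_G = Π_G / cptKer` is Hausdorff (`cptKer` is closed). [cite: MochizukiCombGC2007, Def 1.1(ii) p.7] -/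
theorem t2Space_quotient_cptKer : T2Space (P ⧸ G.cptKer) := by
  haveI := G.cptKer_normal
  haveI : IsClosed (G.cptKer : Set P) := Subgroup.isClosed_topologicalClosure _
  infer_instance

/-- **[CombGC] Rmk. 1.1.6: the compactification `G'` of `G`** over the canonical quotient
`Π^cpt_G = Π_G / Ker(Π_G ↠ Π^cpt_G)` (the group structure on the quotient uses
`PSCDatum.cptKer_normal`; consumers bind it with `haveI := G.cptKer_normal`, or use
`compactifyAlong` with any presentation of `Π^cpt_G`). [cite: MochizukiCombGC2007, Rmk 1.1.6 p.8] -/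
noncomputable def compactify : haveI := G.cptKer_normal; PSCDatum (P ⧸ G.cptKer) :=
  haveI := G.cptKer_normal
  haveI := G.t2Space_quotient_cptKer
  G.compactifyAlong (QuotientGroup.mk' G.cptKer) QuotientGroup.continuous_mk
    (QuotientGroup.mk'_surjective _)

/-- `compactify` is `compactifyAlong` the canonical quotient map. [cite: MochizukiCombGC2007, Rmk 1.1.6 p.8] -/
theorem compactify_eq : G.compactify =
    haveI := G.cptKer_normal; haveI := G.t2Space_quotient_cptKer
    G.compactifyAlong (QuotientGroup.mk' G.cptKer) QuotientGroup.continuous_mk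
      (QuotientGroup.mk'_surjective _) := rfl

end Canonical

/-! ### Origin-level statement: the compactification of a sturdy PSC-type datum is of PSC-type -/

/-- **[CombGC] Remark 1.1.6** (p. 8) as printed, over the origin predicate: "Suppose that `G` is
sturdy. Then observe that the quotient `Π_G ↠ Π^cpt_G` determines a new semi-graph of anabelioids
`G'` of PSC-type … the compactification of `G` … we obtain a natural isomorphism `Π^cpt_G ⥲ Π_{G'}`":
for every sturdy `G` of PSC-type and every presentation `f : Π_G ↠ Q` of `Π^cpt_G` (continuous,
surjective, `ker f = Ker(Π_G ↠ Π^cpt_G)`, `Q` Hausdorff — hence `Q ≅ Π_G / cptKer` as topological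
groups, `Π_G` being compact), the compactification datum along `f` is of PSC-type.
[cite: MochizukiCombGC2007, Rmk 1.1.6 p.8] -/
def CompactifyOfPSCTypeHolds (Ω : PSCOrigin.{u}) : Prop :=
  ∀ ⦃P : Type u⦄ [Group P] [TopologicalSpace P] [IsTopologicalGroup P] [CompactSpace P]
    ⦃Q : Type u⦄ [Group Q] [TopologicalSpace Q] [IsTopologicalGroup Q] [T2Space Q]
    (G : PSCDatum P) (f : P →* Q) (hf : Continuous f) (hs : Function.Surjective f),
    f.ker = G.cptKer → Ω.IsOfPSCType G → G.IsSturdy → Ω.IsOfPSCType (G.compactifyAlong f hf hs)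

end PSCDatum

end Literature.AnabelianGeometry.SemiGraphs
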